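import Summits.QuantumFields.YangMills.Theorems.BalabanUVNodesN15CurvedTransporterLetters
import HarnessLib

/-!
# Route «BalabanUVNodes» (cluster K4 «SpineRates»), Track-A DAG node N15 = NE2, BACKGROUND LAYER AT CURVED `U` — THE ORTHOGONALITY MODEL OF THE TRANSPORTER-FORM
# LINEAGE MADE A THEOREM: exponential coordinate transporters `coordMat e (e^{ηZ})` with SKEW generators (`(coordMat e Z)ᵀ = −coordMat e Z`) are ORTHOGONAL, their
# transpose IS the inverse transport `coordMat e (e^{−ηZ})`; the source of skewness (coordinates orthonormal for a form that `Z` preserves infinitesimally)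

Cell `pub-ymgap`, WIDTH SEAT `pub-ymgap-dag-n15-w2` (director-ym №197 ∕ HUMAN RULING D-0149), generation 2, file 1.  `bears_on: R4∕N15 · K3⁷ SpineGivenEndpointR13SepCoPH
(stmt-QuantumFields-20544)`.  Filed `--kind proof --supports stmt-QuantumFields-20544 --as helper` — COUNT-NEUTRAL; theorems only (0 `def`, 0 `sorry`, 0 `instance`);
imports BY NAME dag-n15-w3's file 5 `…N15CurvedTransporterLetters` (p589511: `expTrField`, `coordMat_mul`, `Phi0_neg_mul_Phi0`; through it file 1 `…N15CurvedLaplacianSpecies`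
(p583814: `gaugePair`), dag-n15-c FILE 28 `…N15CovariantLaplacianSpecies` (`gaugeTransport`, `coordMat_one`, `coordMat_add`), FILE 25 (`coordMat_smul`), n15-b 13a (`Phi0 η Z =
exp(ηZ)`), part 16 `…N15BasisDictionary` (`coordMat`)); nothing in the tree is modified or re-declared.

WHY.  dag-n15-w3's five files (p583814 · p585823 · p586904 · p587618 · p589511) state Bałaban's (3.52)–(3.65) around a CURVED background in TRANSPORTER FORM and carry,
as their standing MODEL HYPOTHESIS, the ORTHOGONALITY of the coordinate transporters: `S_μ(x)S_μ(x)ᵀ = 1` (`hS`), `R_μ(x)ᵀR_μ(x) = R_μ(x)R_μ(x)ᵀ = 1` (`hR`, `hR'`), and in file 5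
the identification `hRt : (expTrField e η W μ y)ᵀ = coordMat e (Φ₀(η, −W_μ(y)))` («the transpose IS the inverse transport»).  File 5's header: *«the ORTHOGONALITY of the
coordinate transporters … remains the MODEL hypothesis of files 1–4 (it holds for an ℓ²-orthonormal `e` and skew `Z`, not derived for a general `e`)»*; the seat's HANDOFF
lists it under «What remains (d)», and dag-n15-w3 g2's `…N15CurvedGradientFit` (INTENT-1, pub-ymgap INBOX l.25917) keeps `hRt` displayed.  THIS FILE DERIVES IT, for the
lineage's own species `S = coordMat e (Φ₀(η, Z)) = coordMat e (exp(ηZ))`, from ONE algebraic hypothesis on the generator — `coordMat e Z` SKEW-SYMMETRIC — which is what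
«coordinates orthonormal for the invariant form» means for `Z = ad_{A′}` ([Balaban1985BackgroundPropagators] (3.37) p. 396: `U′ = exp(iηA′)`, `A′` 𝔤-valued; (3.50) p. 400:
`R(U_b) = exp(iη ad_{A′(b)})` in a real ORTHOGONAL representation of the compact gauge group — the adjoint representation preserves the invariant inner product, so `ad_{A′}`
is skew and `exp(η ad_{A′})` orthogonal).

WHAT (all kernel-checked, no estimate anywhere):
* §1 coordinates: `coordMat_neg`, `coordMat_pow`, `coordMat_apply_single` (the `(i, j)` entry is the `i`-th coordinate of `T` applied to the `j`-th basis vector),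
  `continuous_coordMat` (coordinates are continuous in the operator — finite dimension), ★ `hasSum_coordMat` (coordinates pass to the limit of a series);
* §2 ★★ `transpose_coordMat_exp_of_skew`: `(coordMat e Z)ᵀ = −coordMat e Z ⟹ (coordMat e (exp Z))ᵀ = coordMat e (exp(−Z))` — the exponential SERIES in the complete
  algebra `𝔄 →L[ℝ] 𝔄` transported to `Matrix ι ι ℝ` term by term, `((M)ⁿ)ᵀ = (Mᵀ)ⁿ = (−M)ⁿ`, uniqueness of sums; `transpose_coordMat_Phi0_of_skew` ∕ `…_eq_Phi0_neg`
  (`(coordMat e Φ₀(η,Z))ᵀ = coordMat e Φ₀(η,−Z) = coordMat e Φ₀(−η,Z)`); ★★ `coordMat_Phi0_mul_transpose_of_skew` ∕ `transpose_mul_coordMat_Phi0_of_skew` (`SSᵀ = SᵀS = 1`);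
* §3 the lineage's hypotheses INHABITED for generator-form data: `expTrField_mul_transpose_of_skew` ∕ `expTrField_transpose_mul_of_skew` (files 1–4's `hS`, `hR'`, `hR`),
  ★ `expTrField_transpose_eq_of_skew` (file 5's `hRt`, verbatim shape), ★★ `covShiftLetter_exp_of_skew` (file 5's headline `covShiftLetter_exp` WITH `hRt` REMOVED — one
  application, constant verbatim), `gaugeTransport_inr_eq_transpose_of_skew` + ★ `gaugeTransport_eq_gaugePair_of_skew` (dag-n15-c's two-sided `U ≡ 1` transports ARE file 1's
  lattice-gauge-field reading `gaugePair` of the forward exponential transporter field), `gaugeTransport_mul_transpose_of_skew` ∕ `gaugeTransport_transpose_mul_of_skew`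
  (bondwise orthogonality);
* §4 SOURCE OF SKEWNESS (pure linear algebra, no topology): `coordMat_transpose_eq_neg_of_antisymm` — if the coordinates `e` are ORTHONORMAL for a pairing `B` on `𝔄`
  (`B x y = e x ⬝ᵥ e y`) and `T` is `B`-antisymmetric (`B (T x) y = −B x (T y)`) then `coordMat e T` is skew; `coordMat_adCLM_transpose_eq_neg_of_invariant` — the case
  `T = ad_a` for an `ad`-INVARIANT pairing (`B (a x − x a) y = −B x (a y − y a)`, the trace∕Killing-type form of a compact gauge algebra); `gaugeTransport_mul_transpose_of_invariant`
  (the chain closed: orthonormal coordinates for an `ad`-invariant pairing ⟹ FILE 28's transports bondwise orthogonal);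
* §5 THE `SU(2)` CASE, NO HYPOTHESIS LEFT (non-trivial inhabitant of §4): `quaternion_ad_invariant` (the Euclidean pairing of `ℍ` in the coordinates `(re, i, j, k)` is
  `ad`-invariant at every letter — `ring`), `quaternion_exists_coords` (`ℍ ≃L[ℝ] ℝ⁴`), ★ `quaternion_coordMat_adCLM_transpose_eq_neg` (`coordMat e (ad_a)` skew for every
  `a : ℍ`), `quaternion_adCLM_ne_zero` (`ad_i ≠ 0`: the generators are not the trivial ones), ★★ `quaternion_gaugeTransport_orthogonal` (for EVERY quaternion-valued gauge
  field the `U ≡ 1` transports are bondwise orthogonal — the orthogonality model of the lineage is a THEOREM for the `SU(2)` programme's fibre `ℍ ⊃ 𝔰𝔲(2) = Im ℍ`).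

HONEST FRAMING ∕ LIMITS.  Finite-dimensional linear algebra and the exponential series over the lineage's `exp`∕coordinate species ([B9] (3.37) p. 396, (3.50) p. 400 =
SHAPES; nothing of [B9] asserted); this file REMOVES a displayed model hypothesis (orthogonality ⇐ skew generators ⇐ orthonormal coordinates for an invariant form), it
proves NO estimate: the η-defects ∕ majorants of `G(U)` at the curved `U`, the [B6] gluing and every (3.42)-shaped letter stay exactly where the lineage displays them.
NE2⁺ NOT PRINTED ∕ NOT proved for d = 4; N15 NOT discharged; K3⁷ OPEN, not claimed; counts of record UNMOVED (typed 28∕28 · discharged 5∕27, A 5∕28); one finite 𝕋⁴ at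
fixed ε — NOT infinite volume, NOT OS on ℝ⁴, NOT a mass gap, NOT Clay; R4 closes the conditional finite-𝕋⁴ rung `BalabanLadder.UV` only.  Restate-immune (no Theses import).
-/

set_option autoImplicit false

noncomputable section
open scoped BigOperators Matrix
open Finset NormedSpace

namespace Summit.QuantumFields.YangMills.BalabanUVNodes.N15.CurvedSpecies

open Summit.QuantumFields.YangMills.BalabanUVNodes.N15.MatrixSpecies (Phi0 Phi0_zero coordMat coordMat_sub basisConst)
open Summit.QuantumFields.YangMills.BalabanUVNodes.N15.BackgroundLayer (coordMat_one coordMat_add coordMat_smul gaugeTransport)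
open Literature.MathematicalPhysics.QuantumFieldTheory.Balaban1983to89.Beta.AveragingCorrectionJets (adCLM adCLM_apply)

variable {X ι J : Type} [Fintype ι] [DecidableEq ι] {𝔄 : Type} [NormedRing 𝔄] [NormedAlgebra ℝ 𝔄] [CompleteSpace 𝔄] (e : 𝔄 ≃L[ℝ] (ι → ℝ))

/-! ## §1 Coordinates: negation, powers, entries, continuity, series -/

section Coordinates

omit [CompleteSpace 𝔄] in
/-- Coordinates are linear in the operator: `coordMat e (−T) = −coordMat e T`. [folklore] -/
theorem coordMat_neg (T : 𝔄 →L[ℝ] 𝔄) : coordMat e (-T) = -coordMat e T := by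
  rw [← neg_one_smul ℝ T, coordMat_smul, neg_one_smul]

omit [CompleteSpace 𝔄] in
/-- THE COORDINATE MAP IS A MONOID HOMOMORPHISM ON POWERS: `coordMat e (Tⁿ) = (coordMat e T)ⁿ` (file 5's `coordMat_mul`, FILE 28's `coordMat_one`). [folklore] -/
theorem coordMat_pow (T : 𝔄 →L[ℝ] 𝔄) (n : ℕ) : coordMat e (T ^ n) = coordMat e T ^ n := by
  induction n with
  | zero => rw [pow_zero, pow_zero, coordMat_one]
  | succ n ih => rw [pow_succ, pow_succ, coordMat_mul, ih]

omit [CompleteSpace 𝔄] in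
/-- THE ENTRIES OF THE COORDINATE MATRIX: `(coordMat e T)_{ij}` = the `i`-th coordinate of `T` applied to the `j`-th coordinate vector `e⁻¹(δ_j)`. [folklore] -/
theorem coordMat_apply_single (T : 𝔄 →L[ℝ] 𝔄) (i j : ι) : coordMat e T i j = e (T (e.symm (Pi.single j 1))) i := by
  simp only [coordMat, LinearMap.toMatrix'_apply, ContinuousLinearMap.coe_coe, ContinuousLinearMap.coe_comp, ContinuousLinearEquiv.coe_coe,
    Function.comp_apply]

omit [CompleteSpace 𝔄] in
/-- **COORDINATES ARE CONTINUOUS IN THE OPERATOR** (operator norm on `𝔄 →L[ℝ] 𝔄`, entrywise topology on `Matrix ι ι ℝ`): `𝔄 ≅ ℝ^ι` is finite-dimensional, hence so is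
`𝔄 →L[ℝ] 𝔄`, and the linear map `coordMat e` is continuous. [folklore] -/
theorem continuous_coordMat : Continuous (fun T : 𝔄 →L[ℝ] 𝔄 => coordMat e T) := by
  haveI : FiniteDimensional ℝ 𝔄 := LinearEquiv.finiteDimensional e.symm.toLinearEquiv
  let φ : (𝔄 →L[ℝ] 𝔄) →ₗ[ℝ] Matrix ι ι ℝ :=
    { toFun := fun T => coordMat e T, map_add' := coordMat_add e, map_smul' := fun c T => coordMat_smul e c T }
  exact φ.continuous_of_finiteDimensional

omit [CompleteSpace 𝔄] in
/-- ★ **COORDINATES PASS TO THE LIMIT OF A SERIES**: if `Σ_n T_n = T` in `𝔄 →L[ℝ] 𝔄` then `Σ_n coordMat e T_n = coordMat e T` entrywise. [folklore] -/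
theorem hasSum_coordMat {f : ℕ → (𝔄 →L[ℝ] 𝔄)} {T : 𝔄 →L[ℝ] 𝔄} (h : HasSum f T) : HasSum (fun n => coordMat e (f n)) (coordMat e T) := by
  let φ : (𝔄 →L[ℝ] 𝔄) →+ Matrix ι ι ℝ :=
    { toFun := fun T => coordMat e T, map_zero' := by rw [← sub_self (0 : 𝔄 →L[ℝ] 𝔄), coordMat_sub, sub_self],
      map_add' := coordMat_add e }
  exact h.map φ (continuous_coordMat e)

end Coordinates

/-! ## §2 The transpose of an exponential coordinate transporter with skew generator is the inverse transport -/

section Exponential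

/-- ★★ **SKEW GENERATOR ⟹ THE TRANSPOSE OF THE EXPONENTIAL IS THE EXPONENTIAL OF THE NEGATIVE**: `(coordMat e Z)ᵀ = −coordMat e Z ⟹ (coordMat e (exp Z))ᵀ =
coordMat e (exp(−Z))`.  Proof: the exponential SERIES `Σ (n!)⁻¹ Zⁿ` converges in the complete normed algebra `𝔄 →L[ℝ] 𝔄` (`NormedSpace.exp_series_hasSum_exp'`); coordinates
and transposition are continuous and additive, and term by term `((coordMat e Z)ⁿ)ᵀ = ((coordMat e Z)ᵀ)ⁿ = (−coordMat e Z)ⁿ = coordMat e ((−Z)ⁿ)`; sums are unique. [folklore] -/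
theorem transpose_coordMat_exp_of_skew (Z : 𝔄 →L[ℝ] 𝔄) (hZ : (coordMat e Z)ᵀ = -coordMat e Z) : (coordMat e (exp Z))ᵀ = coordMat e (exp (-Z)) := by
  have h1 : HasSum (fun n : ℕ => ((Nat.factorial n : ℝ)⁻¹) • Z ^ n) (exp Z) := exp_series_hasSum_exp' (𝕂 := ℝ) Z
  have h2 : HasSum (fun n : ℕ => ((Nat.factorial n : ℝ)⁻¹) • (-Z) ^ n) (exp (-Z)) := exp_series_hasSum_exp' (𝕂 := ℝ) (-Z)
  have H1 := (hasSum_coordMat e h1).matrix_transpose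
  have H2 := hasSum_coordMat e h2
  have hfun : (fun n : ℕ => (coordMat e (((Nat.factorial n : ℝ)⁻¹) • Z ^ n))ᵀ) = fun n : ℕ => coordMat e (((Nat.factorial n : ℝ)⁻¹) • (-Z) ^ n) := by
    funext n
    rw [coordMat_smul, coordMat_smul, Matrix.transpose_smul, coordMat_pow, coordMat_pow, Matrix.transpose_pow, hZ, coordMat_neg]
  rw [hfun] at H1
  exact H1.unique H2

omit [CompleteSpace 𝔄] in
/-- Skewness is homogeneous: `coordMat e Z` skew ⟹ `coordMat e (η•Z)` skew. [folklore] -/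
theorem transpose_coordMat_smul_of_skew (η : ℝ) (Z : 𝔄 →L[ℝ] 𝔄) (hZ : (coordMat e Z)ᵀ = -coordMat e Z) : (coordMat e (η • Z))ᵀ = -coordMat e (η • Z) := by
  rw [coordMat_smul, Matrix.transpose_smul, hZ, smul_neg]

/-- `(coordMat e Φ₀(η, Z))ᵀ = coordMat e Φ₀(η, −Z)` for a skew generator (`Φ₀(η, Z) = exp(ηZ)`, n15-b 13a). [folklore] -/
theorem transpose_coordMat_Phi0_of_skew (η : ℝ) (Z : 𝔄 →L[ℝ] 𝔄) (hZ : (coordMat e Z)ᵀ = -coordMat e Z) :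
    (coordMat e (Phi0 η Z))ᵀ = coordMat e (Phi0 η (-Z)) := by
  unfold Phi0
  rw [smul_neg]
  exact transpose_coordMat_exp_of_skew e (η • Z) (transpose_coordMat_smul_of_skew e η Z hZ)

/-- `(coordMat e Φ₀(η, Z))ᵀ = coordMat e Φ₀(−η, Z)` for a skew generator — the backward-bond parametrisation of FILE 28's `gaugeTransport`. [folklore] -/
theorem transpose_coordMat_Phi0_eq_Phi0_neg (η : ℝ) (Z : 𝔄 →L[ℝ] 𝔄) (hZ : (coordMat e Z)ᵀ = -coordMat e Z) :
    (coordMat e (Phi0 η Z))ᵀ = coordMat e (Phi0 (-η) Z) := by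
  rw [transpose_coordMat_Phi0_of_skew e η Z hZ]
  unfold Phi0
  rw [smul_neg, neg_smul]

/-- ★★ **ORTHOGONALITY, RIGHT**: `coordMat e Φ₀(η, Z) · (coordMat e Φ₀(η, Z))ᵀ = 1` for a skew generator (`e^{ηZ}e^{−ηZ} = 1`, file 5's `Phi0_neg_mul_Phi0`). [folklore] -/
theorem coordMat_Phi0_mul_transpose_of_skew (η : ℝ) (Z : 𝔄 →L[ℝ] 𝔄) (hZ : (coordMat e Z)ᵀ = -coordMat e Z) :
    coordMat e (Phi0 η Z) * (coordMat e (Phi0 η Z))ᵀ = 1 := by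
  rw [transpose_coordMat_Phi0_of_skew e η Z hZ, ← coordMat_mul]
  have h := Phi0_neg_mul_Phi0 (𝔅 := 𝔄 →L[ℝ] 𝔄) η (-Z)
  rw [neg_neg] at h
  rw [h, coordMat_one]

/-- ★★ **ORTHOGONALITY, LEFT**: `(coordMat e Φ₀(η, Z))ᵀ · coordMat e Φ₀(η, Z) = 1` for a skew generator (`e^{−ηZ}e^{ηZ} = 1`). [folklore] -/
theorem transpose_mul_coordMat_Phi0_of_skew (η : ℝ) (Z : 𝔄 →L[ℝ] 𝔄) (hZ : (coordMat e Z)ᵀ = -coordMat e Z) :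
    (coordMat e (Phi0 η Z))ᵀ * coordMat e (Phi0 η Z) = 1 := by
  rw [transpose_coordMat_Phi0_of_skew e η Z hZ, ← coordMat_mul, Phi0_neg_mul_Phi0 (𝔅 := 𝔄 →L[ℝ] 𝔄) η Z, coordMat_one]

/-- Entries of an orthogonal exponential transporter are bounded by one (file 1's `abs_entry_le_one_of_orthogonal`, now unconditional for skew generators). [folklore] -/
theorem abs_coordMat_Phi0_entry_le_one_of_skew (η : ℝ) (Z : 𝔄 →L[ℝ] 𝔄) (hZ : (coordMat e Z)ᵀ = -coordMat e Z) (i j : ι) :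
    |coordMat e (Phi0 η Z) i j| ≤ 1 :=
  abs_entry_le_one_of_orthogonal (coordMat_Phi0_mul_transpose_of_skew e η Z hZ) i j

end Exponential

/-! ## §3 The lineage's orthogonality hypotheses inhabited for generator-form data -/

section Fields

variable (η : ℝ) (τ : J → X ≃ X) (Z W : J → X → (𝔄 →L[ℝ] 𝔄))

/-- **`hS` ∕ `hR'` OF FILES 1–4** for the exponential transporter field: `S_μ(x)S_μ(x)ᵀ = 1` when every generator `Z_μ(x)` is skew in coordinates. [folklore] -/
theorem expTrField_mul_transpose_of_skew (hZ : ∀ μ x, (coordMat e (Z μ x))ᵀ = -coordMat e (Z μ x)) (μ : J) (x : X) :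
    expTrField e η Z μ x * (expTrField e η Z μ x)ᵀ = 1 := by
  rw [expTrField_apply]; exact coordMat_Phi0_mul_transpose_of_skew e η (Z μ x) (hZ μ x)

/-- **`hR` OF FILES 1–4** for the exponential transporter field: `R_μ(x)ᵀR_μ(x) = 1` when every generator is skew in coordinates. [folklore] -/
theorem expTrField_transpose_mul_of_skew (hZ : ∀ μ x, (coordMat e (Z μ x))ᵀ = -coordMat e (Z μ x)) (μ : J) (x : X) :
    (expTrField e η Z μ x)ᵀ * expTrField e η Z μ x = 1 := by
  rw [expTrField_apply]; exact transpose_mul_coordMat_Phi0_of_skew e η (Z μ x) (hZ μ x)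

/-- ★ **FILE 5's `hRt` DISCHARGED** (verbatim shape): for a background `R = expTrField e η W` with skew generators, `R_μ(y)ᵀ = coordMat e (Φ₀(η, −W_μ(y)))` — the transpose IS the
inverse transport; ONE application removes the hypothesis `hRt` of `covShiftLetter_exp` (and of dag-n15-w3 g2's `covShiftDefect_exp_eq_coordMat`). [folklore] -/
theorem expTrField_transpose_eq_of_skew (hW : ∀ μ y, (coordMat e (W μ y))ᵀ = -coordMat e (W μ y)) (μ : J) (y : X) :
    (expTrField e η W μ y)ᵀ = coordMat e (Phi0 η (-(W μ y))) := by
  rw [expTrField_apply]; exact transpose_coordMat_Phi0_of_skew e η (W μ y) (hW μ y)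

/-- Entries of the exponential transporter field are bounded by one for skew generators (what files 2–4 extract from `hR'` via `abs_entry_le_one_of_orthogonal`). [folklore] -/
theorem abs_expTrField_entry_le_one_of_skew (hZ : ∀ μ x, (coordMat e (Z μ x))ᵀ = -coordMat e (Z μ x)) (μ : J) (x : X) (i j : ι) :
    |expTrField e η Z μ x i j| ≤ 1 :=
  abs_entry_le_one_of_orthogonal (expTrField_mul_transpose_of_skew e η Z hZ μ x) i j

/-- ★★ **FILE 5's COVARIANT-GRADIENT LETTER WITH `hRt` REMOVED**: dag-n15-w3's `covShiftLetter_exp` (p589511) at a background `R = expTrField e η W` whose generators are SKEW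
in coordinates — the orthogonal-model identification `R_μ(y)ᵀ = coordMat e (Φ₀(η, −W_μ(y)))` is now supplied by `expTrField_transpose_eq_of_skew`, every other hypothesis and
the constant `η²·κ_e·(e·g + e²(2 + e)·r·r_B)` verbatim (ONE application; nothing re-derived). [cite: Balaban1985BackgroundPropagators, (3.37) p.396, (3.52) p.400 (shapes)] -/
theorem covShiftLetter_exp_of_skew {r rB g : ℝ} (hη : 0 ≤ η) (hreg : η * r ≤ 1) (hregB : η * rB ≤ 1) (hZ : ∀ μ x, ‖Z μ x‖ ≤ r) (hW : ∀ μ x, ‖W μ x‖ ≤ rB)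
    (hgrad : ∀ μ x, ‖Z μ x - Z μ ((τ μ).symm x)‖ ≤ η * g) (hWskew : ∀ μ y, (coordMat e (W μ y))ᵀ = -coordMat e (W μ y)) (μ : J) (x : X) (i j : ι) :
    |covShiftDefect τ (expTrField e η W) (expTrField e η Z) μ x i j| ≤
      η ^ 2 * (basisConst e * (Real.exp 1 * g + Real.exp 1 ^ 2 * (2 + Real.exp 1) * r * rB)) :=
  covShiftLetter_exp e η τ Z W hη hreg hregB hZ hW hgrad (expTrField_transpose_eq_of_skew e η W hWskew) μ x i j

variable (A : J → X → 𝔄)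

/-- **THE BACKWARD `U ≡ 1` TRANSPORT IS THE TRANSPOSED FORWARD ONE** for skew `coordMat e (ad A_μ(x))`: FILE 28's `gaugeTransport … (inr μ) x = coordMat e (Φ₀(−η, ad A_μ(x − e_μ)))
= (coordMat e (Φ₀(η, ad A_μ(x − e_μ))))ᵀ` — the print's `U(b̄) = U(b)⁻¹ = U(b)ᵀ` in a real orthogonal representation. [cite: Balaban1985BackgroundPropagators, (3.50) p.400 (shape)] -/
theorem gaugeTransport_inr_eq_transpose_of_skew (hA : ∀ μ x, (coordMat e (adCLM ℝ (A μ x)))ᵀ = -coordMat e (adCLM ℝ (A μ x))) (μ : J) (x : X) :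
    gaugeTransport e τ η A (Sum.inr μ) x = (gaugeTransport e τ η A (Sum.inl μ) ((τ μ).symm x))ᵀ := by
  simp only [gaugeTransport, Sum.elim_inl, Sum.elim_inr]
  rw [transpose_coordMat_Phi0_eq_Phi0_neg e η _ (hA μ ((τ μ).symm x))]

/-- ★ **dag-n15-c's TWO-SIDED `U ≡ 1` TRANSPORTS ARE FILE 1's LATTICE-GAUGE-FIELD READING OF THE FORWARD EXPONENTIAL TRANSPORTER FIELD**: for skew `coordMat e (ad A_μ(x))`,
`gaugeTransport e τ η A = gaugePair τ (expTrField e η (ad ∘ A))` — so every `gaugePair`-keyed statement of the curved lineage (files 1–4) applies to FILE 28's transports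
by `rw`. [cite: Balaban1985BackgroundPropagators, (3.50) p.400 (shape)] -/
theorem gaugeTransport_eq_gaugePair_of_skew (hA : ∀ μ x, (coordMat e (adCLM ℝ (A μ x)))ᵀ = -coordMat e (adCLM ℝ (A μ x))) :
    gaugeTransport e τ η A = gaugePair τ (expTrField e η (fun μ x => adCLM ℝ (A μ x))) := by
  funext b x
  cases b with
  | inl μ => rfl
  | inr μ => rw [gaugeTransport_inr_eq_transpose_of_skew e η τ A hA μ x, gaugePair_inr]; rfl

/-- **BONDWISE ORTHOGONALITY OF THE `U ≡ 1` TRANSPORTS, RIGHT**: `gaugeTransport … b x · (gaugeTransport … b x)ᵀ = 1` on every forward and backward bond, for skew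
`coordMat e (ad A_μ(x))`. [cite: Balaban1985BackgroundPropagators, (3.50) p.400 (shape)] -/
theorem gaugeTransport_mul_transpose_of_skew (hA : ∀ μ x, (coordMat e (adCLM ℝ (A μ x)))ᵀ = -coordMat e (adCLM ℝ (A μ x))) (b : J ⊕ J) (x : X) :
    gaugeTransport e τ η A b x * (gaugeTransport e τ η A b x)ᵀ = 1 := by
  cases b with
  | inl μ => exact coordMat_Phi0_mul_transpose_of_skew e η _ (hA μ x)
  | inr μ => exact coordMat_Phi0_mul_transpose_of_skew e (-η) _ (hA μ ((τ μ).symm x))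

/-- **BONDWISE ORTHOGONALITY OF THE `U ≡ 1` TRANSPORTS, LEFT**: `(gaugeTransport … b x)ᵀ · gaugeTransport … b x = 1`. [cite: Balaban1985BackgroundPropagators, (3.50) p.400 (shape)] -/
theorem gaugeTransport_transpose_mul_of_skew (hA : ∀ μ x, (coordMat e (adCLM ℝ (A μ x)))ᵀ = -coordMat e (adCLM ℝ (A μ x))) (b : J ⊕ J) (x : X) :
    (gaugeTransport e τ η A b x)ᵀ * gaugeTransport e τ η A b x = 1 := by
  cases b with
  | inl μ => exact transpose_mul_coordMat_Phi0_of_skew e η _ (hA μ x)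
  | inr μ => exact transpose_mul_coordMat_Phi0_of_skew e (-η) _ (hA μ ((τ μ).symm x))

end Fields

/-! ## §4 The source of skewness: coordinates orthonormal for a pairing that the generator preserves infinitesimally -/

section Skewness

omit [CompleteSpace 𝔄] in
/-- ★ **ORTHONORMAL COORDINATES + ANTISYMMETRIC OPERATOR ⟹ SKEW COORDINATE MATRIX.**  Let `B : 𝔄 → 𝔄 → ℝ` be any pairing for which the coordinates `e` are ORTHONORMAL
(`B x y = e x ⬝ᵥ e y`, i.e. `B` is the pull-back of the dot product of `ℝ^ι`) and let `T` be `B`-ANTISYMMETRIC (`B (T x) y = −B x (T y)`).  Then `(coordMat e T)ᵀ = −coordMat e T`.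
(Entry `(i, j)` of `coordMat e T` is `B (T e⁻¹δ_j) (e⁻¹δ_i)`.) [folklore] -/
theorem coordMat_transpose_eq_neg_of_antisymm {B : 𝔄 → 𝔄 → ℝ} (hB : ∀ x y, B x y = e x ⬝ᵥ e y) (T : 𝔄 →L[ℝ] 𝔄) (hT : ∀ x y, B (T x) y = -B x (T y)) :
    (coordMat e T)ᵀ = -coordMat e T := by
  have hentry : ∀ i j, coordMat e T i j = B (T (e.symm (Pi.single j 1))) (e.symm (Pi.single i 1)) := by
    intro i j
    rw [coordMat_apply_single, hB, ContinuousLinearEquiv.apply_symm_apply, dotProduct_single, mul_one]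
  ext i j
  rw [Matrix.transpose_apply, Matrix.neg_apply, hentry, hentry, hT, hB (e.symm (Pi.single i 1)), hB (T (e.symm (Pi.single j 1))), dotProduct_comm]

omit [CompleteSpace 𝔄] in
/-- **THE CASE `T = ad_a` FOR AN `ad`-INVARIANT PAIRING**: if `e` is orthonormal for `B` and `B` is `ad`-invariant at the letter `a` (`B (a x − x a) y = −B x (a y − y a)` — the
infinitesimal form of `Ad`-invariance; the trace ∕ Killing-type form of a compact gauge algebra has it for every `a`), then `coordMat e (ad_a)` is skew — the hypothesis of §§2–3
for Bałaban's `R(U_b) = exp(iη ad_{A′(b)})`. [cite: Balaban1985BackgroundPropagators, (3.50) p.400 (shape)] -/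
theorem coordMat_adCLM_transpose_eq_neg_of_invariant {B : 𝔄 → 𝔄 → ℝ} (hB : ∀ x y, B x y = e x ⬝ᵥ e y) (a : 𝔄)
    (hinv : ∀ x y : 𝔄, B (a * x - x * a) y = -B x (a * y - y * a)) : (coordMat e (adCLM ℝ a))ᵀ = -coordMat e (adCLM ℝ a) :=
  coordMat_transpose_eq_neg_of_antisymm e hB (adCLM ℝ a) fun x y => by rw [adCLM_apply, adCLM_apply]; exact hinv x y

/-- ★★ **THE CHAIN CLOSED**: orthonormal coordinates for an `ad`-invariant pairing ⟹ the `U ≡ 1` gauge transports of FILE 28 are bondwise ORTHOGONAL and read as file 1's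
`gaugePair` — the orthogonality MODEL of the curved-`U` lineage holds for Bałaban's species. [cite: Balaban1985BackgroundPropagators, (3.50) p.400 (shape)] -/
theorem gaugeTransport_mul_transpose_of_invariant {B : 𝔄 → 𝔄 → ℝ} (hB : ∀ x y, B x y = e x ⬝ᵥ e y)
    (hinv : ∀ a x y : 𝔄, B (a * x - x * a) y = -B x (a * y - y * a)) (η : ℝ) (τ : J → X ≃ X) (A : J → X → 𝔄) (b : J ⊕ J) (x : X) :
    gaugeTransport e τ η A b x * (gaugeTransport e τ η A b x)ᵀ = 1 ∧ (gaugeTransport e τ η A b x)ᵀ * gaugeTransport e τ η A b x = 1 :=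
  have hA : ∀ μ x, (coordMat e (adCLM ℝ (A μ x)))ᵀ = -coordMat e (adCLM ℝ (A μ x)) := fun μ x => coordMat_adCLM_transpose_eq_neg_of_invariant e hB (A μ x) (hinv (A μ x))
  ⟨gaugeTransport_mul_transpose_of_skew e η τ A hA b x, gaugeTransport_transpose_mul_of_skew e η τ A hA b x⟩

end Skewness

/-! ## §5 The `SU(2)` case: the quaternions in their standard coordinates (a NON-TRIVIAL inhabitant of §4's hypotheses) -/

section Quaternion

open scoped Quaternion

/-- ★ **`ad`-INVARIANCE OF THE EUCLIDEAN PAIRING ON THE QUATERNIONS**: in the standard coordinates `(re, i, j, k)` of `ℍ` (the real envelope of `𝔰𝔲(2) = Im ℍ`), the dot product is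
`ad`-invariant at EVERY letter `a`: `⟨a x − x a, y⟩ = −⟨x, a y − y a⟩` — a polynomial identity in twelve real variables (`ring`).  With §4 this makes `coordMat e (ad_a)` skew
and the exponential transports orthogonal for quaternion-valued gauge fields: the hypotheses of §§2–4 are inhabited NON-TRIVIALLY (non-abelian `𝔄`). [folklore] -/
theorem quaternion_ad_invariant (a x y : ℍ[ℝ]) :
    Quaternion.equivTuple ℝ (a * x - x * a) ⬝ᵥ Quaternion.equivTuple ℝ y = -(Quaternion.equivTuple ℝ x ⬝ᵥ Quaternion.equivTuple ℝ (a * y - y * a)) := by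
  simp only [Quaternion.equivTuple_apply, dotProduct, Fin.sum_univ_four, Matrix.cons_val_zero, Matrix.cons_val_one, Matrix.cons_val_two,
    Matrix.cons_val_three, Matrix.head_cons, Matrix.tail_cons, Quaternion.re_sub, Quaternion.imI_sub, Quaternion.imJ_sub, Quaternion.imK_sub,
    Quaternion.re_mul, Quaternion.imI_mul, Quaternion.imJ_mul, Quaternion.imK_mul]
  ring

/-- THE STANDARD COORDINATE SYSTEM OF `ℍ` AS A CONTINUOUS LINEAR EQUIVALENCE `ℍ ≃L[ℝ] ℝ⁴` (Mathlib's `QuaternionAlgebra.linearEquivTuple`, continuous by finite dimension) —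
the lineage's `e` for `𝔄 = ℍ`. [folklore] -/
theorem quaternion_exists_coords : ∃ e : ℍ[ℝ] ≃L[ℝ] (Fin 4 → ℝ), ∀ x, e x = Quaternion.equivTuple ℝ x :=
  ⟨LinearEquiv.toContinuousLinearEquiv (E := ℍ[ℝ]) (QuaternionAlgebra.linearEquivTuple (-1 : ℝ) (0 : ℝ) (-1 : ℝ)), fun _ => rfl⟩

/-- ★ **`coordMat e (ad_a)` IS SKEW FOR EVERY QUATERNION `a`** in the standard coordinates (§4 `coordMat_adCLM_transpose_eq_neg_of_invariant` with the Euclidean pairing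
`B x y := e x ⬝ᵥ e y` and `quaternion_ad_invariant`). [folklore] -/
theorem quaternion_coordMat_adCLM_transpose_eq_neg (e : ℍ[ℝ] ≃L[ℝ] (Fin 4 → ℝ)) (he : ∀ x, e x = Quaternion.equivTuple ℝ x) (a : ℍ[ℝ]) :
    (coordMat e (adCLM ℝ a))ᵀ = -coordMat e (adCLM ℝ a) :=
  coordMat_adCLM_transpose_eq_neg_of_invariant e (B := fun x y => e x ⬝ᵥ e y) (fun _ _ => rfl) a fun x y => by
    simp only [he]; exact quaternion_ad_invariant a x y

/-- NON-TRIVIALITY (R3-type witness): the generator `ad_i` on `ℍ` is NOT zero (`ad_i j = ij − ji = 2k`), so the skew generators of §§2–4 supplied by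
`quaternion_coordMat_adCLM_transpose_eq_neg` are not the trivial ones — the orthogonality theorems are exercised beyond `Z = 0`. [folklore] -/
theorem quaternion_adCLM_ne_zero : adCLM (𝔸 := ℍ[ℝ]) ℝ ⟨0, 1, 0, 0⟩ ≠ 0 := by
  intro h
  have h1 := congrArg (fun T : ℍ[ℝ] →L[ℝ] ℍ[ℝ] => (T ⟨0, 0, 1, 0⟩).imK) h
  simp only [adCLM_apply, zero_apply, Quaternion.imK_sub, Quaternion.imK_mul, Quaternion.imK_zero] at h1
  norm_num at h1

/-- ★★ **THE ORTHOGONALITY MODEL HOLDS FOR QUATERNION-VALUED GAUGE FIELDS** (the `SU(2)` programme's fibre): in the standard coordinates of `ℍ`, FILE 28's `U ≡ 1` gauge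
transports `coordMat e (exp(±η ad_{A_μ(x)}))` are bondwise ORTHOGONAL for EVERY field `A : J → X → ℍ`, every `η`, with no hypothesis left.
[cite: Balaban1985BackgroundPropagators, (3.50) p.400 (shape)] -/
theorem quaternion_gaugeTransport_orthogonal (e : ℍ[ℝ] ≃L[ℝ] (Fin 4 → ℝ)) (he : ∀ x, e x = Quaternion.equivTuple ℝ x) (η : ℝ) (τ : J → X ≃ X) (A : J → X → ℍ[ℝ])
    (b : J ⊕ J) (x : X) : gaugeTransport e τ η A b x * (gaugeTransport e τ η A b x)ᵀ = 1 ∧ (gaugeTransport e τ η A b x)ᵀ * gaugeTransport e τ η A b x = 1 :=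
  have hA : ∀ μ x, (coordMat e (adCLM ℝ (A μ x)))ᵀ = -coordMat e (adCLM ℝ (A μ x)) := fun μ x => quaternion_coordMat_adCLM_transpose_eq_neg e he (A μ x)
  ⟨gaugeTransport_mul_transpose_of_skew e η τ A hA b x, gaugeTransport_transpose_mul_of_skew e η τ A hA b x⟩

end Quaternion


/-! ## §6 (v1.1, append-only) THE HYPOTHESIS IS SHARP: orthogonality of all exponential transporters `coordMat e (e^{ηZ})`, `η ∈ ℝ`, FORCES a skew generator -/

section Converse

/-- **THE ENTRIES OF THE EXPONENTIAL TRANSPORTER ARE DIFFERENTIABLE IN `η` AT `0` WITH DERIVATIVE THE GENERATOR's ENTRY**: `d/dη|₀ (coordMat e (Φ₀(η, Z)))_{ik} = (coordMat e Z)_{ik}`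
(Mathlib `hasDerivAt_exp_smul_const` in the complete algebra `𝔄 →L[ℝ] 𝔄`, composed with the continuous linear functional `T ↦ (coordMat e T)_{ik}`). [folklore] -/
theorem hasDerivAt_coordMat_Phi0_entry (Z : 𝔄 →L[ℝ] 𝔄) (i k : ι) :
    HasDerivAt (fun η : ℝ => coordMat e (Phi0 η Z) i k) (coordMat e Z i k) 0 := by
  let ℓ : (𝔄 →L[ℝ] 𝔄) →L[ℝ] ℝ :=
    (ContinuousLinearMap.proj i : (ι → ℝ) →L[ℝ] ℝ).comp (((e : 𝔄 →L[ℝ] (ι → ℝ))).comp (ContinuousLinearMap.apply ℝ 𝔄 (e.symm (Pi.single k 1))))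
  have hℓ : ∀ T : 𝔄 →L[ℝ] 𝔄, ℓ T = coordMat e T i k := fun T => by
    rw [coordMat_apply_single]; rfl
  have hexp : HasDerivAt (fun η : ℝ => Phi0 η Z) Z 0 := by
    have e0 : exp ((0 : ℝ) • Z) * Z = Z := by
      change Phi0 0 Z * Z = Z
      rw [Phi0_zero, one_mul]
    exact (hasDerivAt_exp_smul_const (𝕂 := ℝ) Z (0 : ℝ)).congr_deriv e0
  have h2 := ℓ.hasFDerivAt.comp_hasDerivAt (0 : ℝ) hexp
  simp only [Function.comp_def, hℓ] at h2
  exact h2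

/-- ★★ **CONVERSE OF §2 — SKEWNESS IS NECESSARY**: if `coordMat e (Φ₀(η, Z))` is orthogonal for EVERY `η ∈ ℝ` then `(coordMat e Z)ᵀ = −coordMat e Z` (differentiate the constant
`(S(η)S(η)ᵀ)_{ij} = δ_{ij}` at `η = 0`: `0 = Z_{ij} + Z_{ji}`).  With `coordMat_Phi0_mul_transpose_of_skew` the orthogonality MODEL of the lineage for the exponential species is
EQUIVALENT to skewness of the generator's coordinate matrix — the hypothesis of §§2–3 cannot be weakened. [folklore] -/
theorem skew_of_forall_coordMat_Phi0_mul_transpose (Z : 𝔄 →L[ℝ] 𝔄) (h : ∀ η : ℝ, coordMat e (Phi0 η Z) * (coordMat e (Phi0 η Z))ᵀ = 1) :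
    (coordMat e Z)ᵀ = -coordMat e Z := by
  ext i j
  rw [Matrix.transpose_apply, Matrix.neg_apply]
  have hF : ∀ a b, HasDerivAt (fun η : ℝ => coordMat e (Phi0 η Z) a b) (coordMat e Z a b) 0 := hasDerivAt_coordMat_Phi0_entry e Z
  have h0 : ∀ a b, coordMat e (Phi0 0 Z) a b = (1 : Matrix ι ι ℝ) a b := fun a b => by
    rw [Phi0_zero, coordMat_one]
  have hG : HasDerivAt (fun η : ℝ => ∑ k, coordMat e (Phi0 η Z) i k * coordMat e (Phi0 η Z) j k)
      (∑ k, (coordMat e Z i k * (1 : Matrix ι ι ℝ) j k + (1 : Matrix ι ι ℝ) i k * coordMat e Z j k)) 0 := by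
    refine HasDerivAt.fun_sum fun k _ => ?_
    have hm := (hF i k).mul (hF j k)
    simp only [h0] at hm
    exact hm
  have hconst : (fun η : ℝ => ∑ k, coordMat e (Phi0 η Z) i k * coordMat e (Phi0 η Z) j k) = fun _ => (1 : Matrix ι ι ℝ) i j := by
    funext η
    have := congrArg (fun M : Matrix ι ι ℝ => M i j) (h η)
    simpa [Matrix.mul_apply, Matrix.transpose_apply] using this
  rw [hconst] at hG
  have hzero := hG.unique (hasDerivAt_const (0 : ℝ) ((1 : Matrix ι ι ℝ) i j))
  simp only [Matrix.one_apply, mul_ite, mul_one, mul_zero, ite_mul, one_mul, zero_mul, Finset.sum_add_distrib, Finset.sum_ite_eq, Finset.mem_univ, if_true] at hzero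
  linarith

/-- ★★ **THE ORTHOGONALITY MODEL OF THE EXPONENTIAL SPECIES ⟺ SKEW GENERATOR** (`coordMat_Phi0_mul_transpose_of_skew` + `skew_of_forall_coordMat_Phi0_mul_transpose`). [folklore] -/
theorem forall_coordMat_Phi0_mul_transpose_iff_skew (Z : 𝔄 →L[ℝ] 𝔄) :
    (∀ η : ℝ, coordMat e (Phi0 η Z) * (coordMat e (Phi0 η Z))ᵀ = 1) ↔ (coordMat e Z)ᵀ = -coordMat e Z :=
  ⟨skew_of_forall_coordMat_Phi0_mul_transpose e Z, fun hZ η => coordMat_Phi0_mul_transpose_of_skew e η Z hZ⟩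

end Converse

end Summit.QuantumFields.YangMills.BalabanUVNodes.N15.CurvedSpecies

end
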